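import Summits.RiemannHypothesis.RiemannHypothesis.Theorems.GroundBartaEvenWinsBeyondArchDeflationResidualLoc
import HarnessLib

/-!
# RiemannHypothesis / GroundBarta — rung 4 (`EvenWinsBeyondArch`, stmt-RiemannHypothesis-18807 / 18085):
# the deflated Temple L-side beyond `(log 5)/2`, XVII b′ (four slots) — the residual of one bulk y-panel with FOUR prime slots

Helper file (`--supports stmt-RiemannHypothesis-18807`), RH-free, Mathlib + landed tree files only, no facts.  rh-explicit seat
weil-5 (lead ruling R3-8a, 2026-08-22), four-slot twin of prover B's `dt_residualLocTM` / `dt_tmem_residualLocTM`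
(…DeflationResidualLoc, file XVII b′): on the `{2,3,4,5}`-window (`(log 5)/2 < c ≤ (log 7)/2`, first cells `c = 83/100`, `97/100`)
the prime sum of a window image has FOUR slots `(log 2/√2, log 2)`, `(log 3/√3, log 3)`, `(log 2/2, log 4)`, `(log 5/√5, log 5)`
(`dt_hprimes_four`, …DeflationWindowConst4, prover A g12), so the per-panel Taylor model of the residual carries one more
`dt_primeLocTM` term.  Everything else (pole, arch `E + H`, tails, killing polynomial) is B's v2 machinery VERBATIM; the proof is
B's proof with one more `tmem_add`.  `dt_residualLocTM4` / `dt_tmem_residualLocTM4`: same statement shape as the three-slot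
theorem plus the slot `s4 = (Iw4, IL4, flags)` with `w4 ∈ Iw4`, `L4 ∈ IL4`.

References: E. Bombieri, Rend. Mat. Acc. Lincei (9) 11 (2000) Thm 2 [Bombieri2000Weil]; K. Makino, M. Berz (2003).
-/

set_option linter.dupNamespace false

noncomputable section

open MeasureTheory Set Filter intervalIntegral Finset
open scoped Topology BigOperators

namespace Summit.RiemannHypothesis.RiemannHypothesis.Theorems.EvenWinsBeyondArch

open Literature.NumberTheory.LFunctions
open Literature.Analysis.ValidatedNumerics Literature.Analysis.ValidatedNumerics.PolyMP
  Literature.Analysis.ValidatedNumerics.NumericsMP Literature.Analysis.ValidatedNumerics.ExpPoly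

/-- **The v2 residual Taylor model of bulk panel `k`, FOUR prime slots** (all arguments kernel data; `tab` the even-grid table function,
`Dρ` the ρ-panel models with references, `mu` their moments, `M0` the G-moments on `[0, 2h]`, `Pc Ps` the pole integrals,
`Eyp Eym ∋ e^{±y_k/2}`, `PsiFar ∋ Ψ(2c)`). -/
def dt_residualLocTM4 (S : ℕ) (c : ℚ) (m k Dl K : ℕ) (gp pk : Poly) (tab : ℤ → IPoly × ℤ × ℤ)
    (Dρ : List (IPoly × Poly)) (mu : ℕ → List MI) (M0 : List MI) (PsiFar Pc Ps Eyp Eym : MI)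
    (s1 s2 s3 s4 : MI × MI × Bool × Bool) : IPoly :=
  let h : ℚ := c / (2 * m)
  let y0 : ℚ := PolyMP.panelCentre h k
  let A0 := dt_locI S gp (ofRat S y0)
  let Gy := ttruncI S h Dl A0
  let W : ℕ → IPoly := fun i ↦ (Dρ.getD i default).1
  let pw : ℕ → Poly := fun i ↦ (Dρ.getD i default).2
  let pole := dt_poleTM S h K Pc Ps Eyp Eym
  let primes := taddI (taddI (taddI (dt_primeLocTM S h Dl gp y0 Gy s1) (dt_primeLocTM S h Dl gp y0 Gy s2))
    (dt_primeLocTM S h Dl gp y0 Gy s3)) (dt_primeLocTM S h Dl gp y0 Gy s4)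
  let arch := taddI (dt_archETM S c m k Dl A0 M0 Gy tab mu W pw) (dt_archHTM S c m k Dl Gy tab mu W pw)
  let psi := tmulI S h Dl Gy (taddI (treflI (weilArchTailTM S h Dρ (m - 1 - k) PsiFar)) (weilArchTailTM S h Dρ (m + k) PsiFar))
  ttruncI S h Dl (taddI (taddI (taddI (taddI pole primes) arch) psi) (dt_locTM S h Dl pk (ofRat S y0)))

/-- **The flagged four-slot residual on a bulk panel, enclosed (v2).**  Grid `0 < c`, `k + 2 ≤ m`, `h = c/(2m) ≤ 2`, `K > 0`; pole
enclosures `Pc ∋ ∫_{-c}^{c} g cosh(x/2)`, `Ps ∋ ∫ g sinh(x/2)`, `Ey± ∋ e^{±y_k/2}`; the even-grid table of `g` (`|n| ≤ m`, length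
`Dl+1`, radius `2h`); ρ-panel models `Dρ` (`1 ≤ i < 2m`, length `2m`) with moments `mu` up to order `Dl`; G-moments `M0` on panel 0;
`Ψ(2c) ∈ PsiFar`; the FOUR slots' reals `w_j ∈`, `L_j ∈` (`j ≤ 4`).  Conclusion: the flagged real residual at `y = y_k + ρ` lies in
`dt_residualLocTM …` for `|ρ| ≤ h`. [cite: Bombieri2000Weil, Thm 2 (explicit formula: pole, prime and archimedean terms)] -/
theorem dt_tmem_residualLocTM4 {S : ℕ} (hS : 0 < S) {c : ℚ} (hc : 0 < c) {m k : ℕ} (hkm : k + 2 ≤ m)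
    (hh2 : c / (2 * m) ≤ 2) (Dl : ℕ) {K : ℕ} (hK : 0 < K) (gp pk : Poly)
    {tab : ℤ → IPoly × ℤ × ℤ}
    (htab : ∀ n : ℤ, -(m : ℤ) ≤ n → n ≤ m →
      TabOK S (2 * (c / (2 * m))) (fun s ↦ Poly.eval gp (2 * (n : ℝ) * ((c / (2 * m) : ℚ) : ℝ) + s))
        (tab n).1 (tab n).2.1 (tab n).2.2)
    (htabl : ∀ n : ℤ, -(m : ℤ) ≤ n → n ≤ m → (tab n).1.length = Dl + 1)
    (Dρ : List (IPoly × Poly)) (hDρl : Dρ.length = 2 * m)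
    (hDρ : ∀ i : Fin Dρ.length, 1 ≤ (i : ℕ) →
      TMem S (c / (2 * m)) (fun u ↦ weilArchDensity ((PolyMP.panelCentre (c / (2 * m)) i : ℝ) + u)) (Dρ.get i).1)
    {mu : ℕ → List MI}
    (hmu : ∀ i, 1 ≤ i → i < 2 * m → ∀ b, b < Dl + 1 →
      MI.mem S (∫ u in (-((c / (2 * m) : ℚ) : ℝ))..((c / (2 * m) : ℚ) : ℝ),
        weilArchDensity (((PolyMP.panelCentre (c / (2 * m)) i : ℚ) : ℝ) + u) * u ^ b) ((mu i).getD b default))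
    {M0 : List MI} (hM0 : ∀ j, j + 1 < gp.length →
      MI.mem S (∫ t in (0 : ℝ)..(2 * ((c / (2 * m) : ℚ) : ℝ)), weilArchDensityG t * t ^ j) (M0.getD j default))
    {PsiFar Pc Ps Eyp Eym : MI} (hFar : MI.mem S (weilArchTail (2 * (c : ℝ))) PsiFar)
    (hPc : MI.mem S (∫ x in (-(c : ℝ))..c, Poly.eval gp x * Real.cosh (x / 2)) Pc)
    (hPs : MI.mem S (∫ x in (-(c : ℝ))..c, Poly.eval gp x * Real.sinh (x / 2)) Ps)
    (hEyp : MI.mem S (Real.exp ((PolyMP.panelCentre (c / (2 * m)) k : ℝ) / 2)) Eyp)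
    (hEym : MI.mem S (Real.exp (-((PolyMP.panelCentre (c / (2 * m)) k : ℝ) / 2))) Eym)
    (s1 s2 s3 s4 : MI × MI × Bool × Bool) {w1 L1 w2 L2 w3 L3 w4 L4 : ℝ}
    (hw1 : MI.mem S w1 s1.1) (hL1 : MI.mem S L1 s1.2.1) (hw2 : MI.mem S w2 s2.1) (hL2 : MI.mem S L2 s2.2.1)
    (hw3 : MI.mem S w3 s3.1) (hL3 : MI.mem S L3 s3.2.1) (hw4 : MI.mem S w4 s4.1) (hL4 : MI.mem S L4 s4.2.1) :
    TMem S (c / (2 * m)) (fun ρ ↦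
      (2 * (∫ x in (-(c : ℝ))..c, Poly.eval gp x * Real.cosh (x / 2)) *
          Real.cosh ((((PolyMP.panelCentre (c / (2 * m)) k : ℚ) : ℝ) + ρ) / 2) -
        2 * (∫ x in (-(c : ℝ))..c, Poly.eval gp x * Real.sinh (x / 2)) *
          Real.sinh ((((PolyMP.panelCentre (c / (2 * m)) k : ℚ) : ℝ) + ρ) / 2)) +
      (dt_primeSlotFn gp w1 L1 s1.2.2.1 s1.2.2.2 (((PolyMP.panelCentre (c / (2 * m)) k : ℚ) : ℝ) + ρ) +
        dt_primeSlotFn gp w2 L2 s2.2.2.1 s2.2.2.2 (((PolyMP.panelCentre (c / (2 * m)) k : ℚ) : ℝ) + ρ) +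
        dt_primeSlotFn gp w3 L3 s3.2.2.1 s3.2.2.2 (((PolyMP.panelCentre (c / (2 * m)) k : ℚ) : ℝ) + ρ) +
        dt_primeSlotFn gp w4 L4 s4.2.2.1 s4.2.2.2 (((PolyMP.panelCentre (c / (2 * m)) k : ℚ) : ℝ) + ρ)) +
      ((∫ t in Ioc 0 ((c : ℝ) - ((((PolyMP.panelCentre (c / (2 * m)) k : ℚ) : ℝ) + ρ))),
          weilArchDensityG t * ((2 * Poly.eval gp ((((PolyMP.panelCentre (c / (2 * m)) k : ℚ) : ℝ) + ρ)) -
            Poly.eval gp ((((PolyMP.panelCentre (c / (2 * m)) k : ℚ) : ℝ) + ρ) - t) -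
            Poly.eval gp ((((PolyMP.panelCentre (c / (2 * m)) k : ℚ) : ℝ) + ρ) + t)) / t)) +
        ∫ t in Ioc ((c : ℝ) - ((((PolyMP.panelCentre (c / (2 * m)) k : ℚ) : ℝ) + ρ)))
            ((c : ℝ) + ((((PolyMP.panelCentre (c / (2 * m)) k : ℚ) : ℝ) + ρ))),
          weilArchDensityG t * ((Poly.eval gp ((((PolyMP.panelCentre (c / (2 * m)) k : ℚ) : ℝ) + ρ)) -
            Poly.eval gp ((((PolyMP.panelCentre (c / (2 * m)) k : ℚ) : ℝ) + ρ) - t)) / t)) +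
      Poly.eval gp ((((PolyMP.panelCentre (c / (2 * m)) k : ℚ) : ℝ) + ρ)) *
        (weilArchTail ((c : ℝ) - ((((PolyMP.panelCentre (c / (2 * m)) k : ℚ) : ℝ) + ρ))) +
          weilArchTail ((c : ℝ) + ((((PolyMP.panelCentre (c / (2 * m)) k : ℚ) : ℝ) + ρ)))) +
      Poly.eval pk ((((PolyMP.panelCentre (c / (2 * m)) k : ℚ) : ℝ) + ρ)))
      (dt_residualLocTM4 S c m k Dl K gp pk tab Dρ mu M0 PsiFar Pc Ps Eyp Eym s1 s2 s3 s4) := by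
  set h : ℚ := c / (2 * m) with hh
  set y0 : ℚ := PolyMP.panelCentre h k with hy0
  have hm : 0 < m := by omega
  have hk : k < m := by omega
  have hmq : (0 : ℚ) < m := by exact_mod_cast hm
  have hh0 : 0 < h := by rw [hh]; positivity
  have hgc : Continuous fun x ↦ Poly.eval gp x := Poly.continuous_eval gp
  -- local data at `y0`
  have hloc := dt_locI_spec hS gp (mem_ofRat S y0)
  have hGy : TMem S h (fun s ↦ Poly.eval gp ((y0 : ℝ) + s)) (ttruncI S h Dl (dt_locI S gp (ofRat S y0))) :=
    tmem_trunc hh0.le Dl (dt_tmem_locI hS h gp (mem_ofRat S y0))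
  -- pole
  have hpole := dt_tmem_poleTM hS hh0.le hh2 hK hPc hPs (y0 := (y0 : ℝ)) hEyp hEym
  -- primes
  have hpr := tmem_add (tmem_add (tmem_add (dt_tmem_primeLocTM hS hh0.le Dl gp y0 hGy s1 hw1 hL1)
    (dt_tmem_primeLocTM hS hh0.le Dl gp y0 hGy s2 hw2 hL2)) (dt_tmem_primeLocTM hS hh0.le Dl gp y0 hGy s3 hw3 hL3))
    (dt_tmem_primeLocTM hS hh0.le Dl gp y0 hGy s4 hw4 hL4)
  -- ρ-panel models as functions of the index
  have hW : ∀ i, 1 ≤ i → i < 2 * m →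
      TMem S h (fun u ↦ weilArchDensity (((PolyMP.panelCentre h i : ℚ) : ℝ) + u)) (Dρ.getD i default).1 := by
    intro i hi1 hi2
    have hi : i < Dρ.length := by rw [hDρl]; exact hi2
    have := hDρ ⟨i, hi⟩ hi1
    rwa [List.get_eq_getElem, ← List.getD_eq_getElem (d := default)] at this
  -- arch
  have hlenA : (dt_locI S gp (ofRat S y0)).length = gp.length := dt_length_locI S gp _
  have hM0' : ∀ j, j + 1 < (dt_locI S gp (ofRat S y0)).length →
      MI.mem S (∫ t in (0 : ℝ)..(2 * (h : ℝ)), weilArchDensityG t * t ^ j) (M0.getD j default) := by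
    intro j hj; exact hM0 j (by rw [hlenA] at hj; exact hj)
  have hE := dt_tmem_archE (Dl := Dl) hS hc hkm hgc hloc.1 hloc.2 hGy htab htabl hW (fun i ↦ (Dρ.getD i default).2) hmu hM0'
  have hH := dt_tmem_archH (Dl := Dl) hS hc hkm hgc hloc.2 hGy htab htabl hW (fun i ↦ (Dρ.getD i default).2) hmu
  -- tails
  have hFar' : MI.mem S (weilArchTail (2 * Dρ.length * h)) PsiFar := by
    have e : (2 * Dρ.length * h : ℝ) = 2 * (c : ℝ) := by
      rw [hDρl, hh]; push_cast; field_simp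
    rwa [e]
  have hjn1 : 1 ≤ m - 1 - k := by omega
  have hjnN : m - 1 - k < Dρ.length := by rw [hDρl]; omega
  have hjfN : m + k < Dρ.length := by rw [hDρl]; omega
  have hnear := tmem_refl (tmem_weilArchTailTM hS hh0 Dρ hjn1 hjnN hDρ hFar')
  have hfarT := tmem_weilArchTailTM hS hh0 Dρ (by omega : 1 ≤ m + k) hjfN hDρ hFar'
  have hcn : ((PolyMP.panelCentre h (m - 1 - k) : ℚ) : ℝ) = (c : ℝ) - (y0 : ℝ) := by
    rw [hy0, hh]; exact (dt_c_sub_y0 hk).symm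
  have hcf : ((PolyMP.panelCentre h (m + k) : ℚ) : ℝ) = (c : ℝ) + (y0 : ℝ) := by
    rw [hy0, hh]; exact (dt_c_add_y0 (c := c) (k := k) hm).symm
  have hpsi := tmem_mul hS hh0.le Dl hGy (tmem_add hnear hfarT)
  -- the polynomial term
  have hpk := dt_tmem_locTM hS hh0.le Dl pk (mem_ofRat S y0)
  -- assemble
  have hall := tmem_trunc hh0.le Dl (tmem_add (tmem_add (tmem_add (tmem_add hpole hpr) (tmem_add hE hH)) hpsi) hpk)
  refine tmem_congr_on hall fun ρ _ ↦ ?_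
  rw [hcn, hcf]
  have e1 : (c : ℝ) - (y0 : ℝ) + -ρ = (c : ℝ) - ((y0 : ℝ) + ρ) := by ring
  have e2 : (c : ℝ) + (y0 : ℝ) + ρ = (c : ℝ) + ((y0 : ℝ) + ρ) := by ring
  rw [e1, e2]

end Summit.RiemannHypothesis.RiemannHypothesis.Theorems.EvenWinsBeyondArch

end
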